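import Summits.Ventures.QEC.CircuitDistance.PortK2DataBB144Z
import Summits.Ventures.QEC.CircuitDistance.K2Chunks
import HarnessLib

/-!
# K2(`[[144,12,12]]`) chunk module — COMPUTATIONAL (native_decide; `Lean.ofReduceBool`)

Cell `qec`, CDX, R146/R152 STEP 1 («computational» header; `ofReduceBool` confined to these chunk modules). Checker of record
`K2.K2Data` (qec-cdx-type-1, PortK2Check); data module of record `PortK2DataBB144X/Z` (p669158/9, crit-1 data audit PASS
2026-08-28T21:20Z); chunk glue `K2Chunks` (idea-1 g2). Cube 1, child 2: leaf group 2 of 4.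
Leaf theorems: the K2 DFS accepts below one descendant state of pivot cube 1 (sector Z); sizes are exact DFS visit counts
(eng-1 g2 `k2count.c`), capped so that the gate's native-axiom audit re-verifies every leaf in place. Assemblies re-derive the
child lists in the kernel (`decide`) and end in the literal cube fact `d144Z.cube (Ts144Z.getD 1 []) (72) (lives144Z.getD 1 0) = true`
(the `hcubes` hypothesis of `K2Inst.k2_complete`). Emitted by qec-cdx-eng-1 g2 (`gen2.py`, idea-1's `gen_k2chunks_from_lean.py` lineage).
-/

namespace Summit.Ventures.QEC.CircuitDistance.K2

set_option maxRecDepth 100000 in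
set_option maxHeartbeats 0 in
set_option exponentiation.threshold 1024 in
/-- K2(144) chunk fact `cube144Z1_ch2_5` (577897 DFS visits; see the module docstring). -/
theorem cube144Z1_ch2_5 : app5 (d144Z.dfs (Ts144Z.getD 1 []) 6) (154887258112, 0, 6427752177035961191370829163487142976236407432207487010340864, 3, 2348542582773833227889480596789337027375682548901791488743059592614842607188037600457479479708718286581530624) = true := by native_decide

set_option maxRecDepth 100000 in
set_option maxHeartbeats 0 in
set_option exponentiation.threshold 1024 in
/-- K2(144) chunk fact `cube144Z1_ch2_6` (295011 DFS visits; see the module docstring). -/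
theorem cube144Z1_ch2_6 : app5 (d144Z.dfs (Ts144Z.getD 1 []) 6) (1876877378089648128, 0, 822752278660603021166687572072797745057515528273866247343439872, 3, 2348542582773833227889480596789337027375682548079039210082456571537358015909362347966111546891928354907226112) = true := by native_decide

set_option maxRecDepth 100000 in
set_option maxHeartbeats 0 in
set_option exponentiation.threshold 1024 in
/-- K2(144) chunk fact `cube144Z1_ch2_7` (279136 DFS visits; see the module docstring). -/
theorem cube144Z1_ch2_7 : app5 (d144Z.dfs (Ts144Z.getD 1 []) 6) (592053340388164894720, 0, 6582018229284824168709079711023524512497091057991395769063571456, 3, 2348542582773833227889480596789337027375682541497020980797632402917481285679960328035168084357608901512790016) = true := by native_decide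

set_option maxRecDepth 100000 in
set_option maxHeartbeats 0 in
set_option exponentiation.threshold 1024 in
/-- K2(144) chunk fact `cube144Z1_ch2_8` (562091 DFS visits; see the module docstring). -/
theorem cube144Z1_ch2_8 : app5 (d144Z.dfs (Ts144Z.getD 1 []) 6) (75516358551748476944, 1860, 421249166674228746791761313715475851768146529197653521332913045504, 3, 2348542582773833227889480596789337027375682120247854306568885611245370550998231052454786482161163884268879872) = true := by native_decide

set_option maxRecDepth 100000 in
set_option maxHeartbeats 0 in
set_option exponentiation.threshold 1024 in
/-- K2(144) chunk fact `cube144Z1_ch2_9` (423877 DFS visits; see the module docstring). -/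
theorem cube144Z1_ch2_9 : app5 (d144Z.dfs (Ts144Z.getD 1 []) 6) (577587768902029312, 24, 463168356949264781694283940034751720616060732785054822305425793107968187695104, 3, 2348542582773833227889480596788873859018732855466160022628850859613957471059568490198628651825132231750320128) = true := by native_decide
end Summit.Ventures.QEC.CircuitDistance.K2
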